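import Summits.CriticalPhenomena.PercolationContinuityZ3.Theorems.PercNearOneGluingNoHeavyConstsConditionedMarker
import HarnessLib

/-!
# The Y-split of MDL(X)′: the conditioned marker inequality (theorem), the exact split identity, and the
# marker-split statement S0 that implies `Consts.MDLXJoint` functional by functional — S0 itself is REFUTED (`Consts.not_markerSplit`)
# (PAPER-2 track (ii); seat `prim-consts-2`, gen 16)

builds on p205010 (kernel theorem, internal audit signed; external expert review pending).  Support file (`--supports
stmt-CriticalPhenomena-4575`); memo `run/shared/lean/prim/consts/FROM-prim-consts-2-g16-MARKER-SPLIT.md`.  One `Prop` definition (an OPEN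
conjecture as typed; REFUTED the same day by `Consts.not_markerSplit` in `…ConstsMarkerSplitRefutation.lean` — this docstring refresh records it),
theorems; no sorries; standard axioms.

Notation (as in `…ConstsMDLXJoint.lean`): owner `s`, avoided set `X`, markers `y, z`; `D = {s ↮ X}`, `𝒜 = {y ↮ {s}∪X}`, `T = 𝒜 ∩ D`,
`Y = {s ↔ y}`, `N = Yᶜ`, `Z = {s ↔ z}`, `W = {y ↔ z}`, `p' = μ(T∩W)/μ(T)`; `F` a monotone functional of the open edge cluster `C_s`
with `0 ≤ F ≤ 1`, and the complementary antitone functional `1 − F`.  Write `I_A = ∫_{D∩A} F`, `K_A = ∫_{D∩A} (1 − F)`.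
`Consts.MDLXJoint` at `F` reads `μ(T∩W)·[μ(D) I_Y − I μ(D∩Y)] ≤ μ(T)·[μ(D) I_Z − I μ(D∩Z)]`.

SPLITTING THE MARKER EVENT `Y`.  With `Γ := μ(T∩W) K_N + μ(T) K_{N∩Z}` the three quantities
  `C2 := μ(T) K_N I_{Y∩Z} − Γ I_Y`      ("upper conditioned marker slack"),
  `C0 := μ(T) K_N K_{Y∩Z} − Γ K_Y`      ("lower conditioned marker slack"),
  `P1 := μ(D∩N) I_{N∩Z} − μ(D∩N∩Z) I_N` (a positive-association slack given `s ↮ X ∪ {y}`)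
satisfy the EXACT IDENTITY (pure algebra, `Consts.mdlx_markerSplit_identity`)
  `K_N · MDLX(F) = K · C2 − I · C0 + K · μ(T) · P1`,   `I = ∫_D F`, `K = ∫_D (1−F)`.
For the indicator `F = 1_U` of an up-event of `C_s` this is `MDLX(U)/(ν(U)ν(Uᶜ)) = (a₁−b₀−p')ν(Y|U) − (a₀−b₀−p')ν(Y|Uᶜ) + (b₁−b₀)ν(N|U)`
with `a₁ = ν(Z|U,Y)`, `a₀ = ν(Z|Uᶜ,Y)`, `b₁ = ν(Z|U,N)`, `b₀ = ν(Z|Uᶜ,N)`, `ν = μ(·|D)`.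

* `Consts.conditionedMarker_ge` (companion file `…ConstsConditionedMarker.lean`) — **THEOREM (C2 ≥ 0, generalising the marker corner `Consts.mdlxJoint_connIndicator` to every functional):**
  for every monotone `F ≥ 0` and antitone `G ≥ 0`:  `I_Y · (μ(T∩W) ∫_{D∩N} G + μ(T) ∫_{D∩N∩Z} G) ≤ I_{Y∩Z} · μ(T) · ∫_{D∩N} G`,
  i.e. for `F = 1_U`, `G = 1_{Uᶜ}`:  `ν(Z | U, Y) ≥ p' + ν(Z | Uᶜ, N)`.  PROOF: (1) van den Berg–Häggström–Kahn Thm 1.3 WITH SETS for the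
  source set `{s,y}` repelled from `X` (`E₁ = {s,y}↮X`): the functionals `F(K)·1{s↔y in K}` and `1{z ∈ V(K)}` of `K = C_s ∪ C_y` are increasing,
  and `1{z∈V(K)}`, `1{s↮y in K}` are increasing/antitone (`Consts.twoSource_sameSource_mixed`), whence `I_{Y∩Z}·μ(T) ≥ I_Y·μ(T∩(Z∪W))`;
  (2) the same mixed inequality for the source `s` repelled from `X∪{y}`: `(∫_{D∩N∩Z} G)·μ(D∩N) ≤ (∫_{D∩N} G)·μ(D∩N∩Z)`; (3) Thm 1.4 with sets
  (`{s}` vs `X∪{y}`): `μ(T)μ(D∩N∩Z) ≤ μ(T∩Z)μ(D∩N)`.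
* `Consts.markerPA_ge` (companion file) — `P1 ≥ 0` (BHK Thm 1.3 with sets, source `s` repelled from `X ∪ {y}`).
* `Consts.mdlx_markerSplit_identity` — the identity above (ring arithmetic on the pieces).
* `Consts.mdlxJoint_of_markerSplit` — **`K·C2 ≥ I·C0` ("marker split", S0) implies MDL(X)′ at `F`** (given `K_N > 0`).
* `Consts.mdlxJoint_of_lowerMarker_le` — **THEOREM: MDL(X)′ holds at every `F` whose lower slack `C0 ≤ 0`** (by C2 ≥ 0 and the identity) —
  for indicators: at every up-event `U` with `ν(Z|Uᶜ,Y) ≤ p' + ν(Z|Uᶜ,N)` (in the census below: ≈ 85 % of the vertex-measurable up-events,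
  ≈ 20 % of the edge-level ones).
* `Consts.MarkerSplit` — **S0, typed as a conjecture and REFUTED the same day** (`Consts.not_markerSplit`, `…ConstsMarkerSplitRefutation.lean`;
  five vertices, `X = ∅`, `s=0,y=1,z=2`, pairs `14:1/2, 03:1/2, 02:7/8, 23:1/2, 34:31/32, 04:3/4`, `F = 1{03 ∈ C_s}`: `I·C0 − K·C2 = 3784113/2³⁷ > 0`
  while MDL(X)′ holds there): `K·C2 ≥ I·C0` for every monotone `0 ≤ F ≤ 1`, i.e. for indicators `Cov_ν(U, Y∩Z) ≥ (p' + ν(Z|Uᶜ,N))·Cov_ν(U, Y)`.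
  It implies `Consts.MDLXJoint` functional by functional (`mdlxJoint_of_markerSplit`, which stays useful wherever S0 holds) and is stronger only by
  the PA term `K·μ(T)·P1` — which the witness shows to be LOAD-BEARING.  EVIDENCE (exact rational arithmetic; engines `prim-consts-2/g16/engines/{split1,s0test,s0cone,kgen}.py`;
  `U` over ALL up-sets of the realised EDGE-cluster poset when it has ≤ 14–16 elements, else a menu of vertex/pair/principal/random up-sets):
  n = 5 edge-level 10 886 + 8 183 + 8 011 + 7 932 up-events, n = 5 vertex-level 2 910, n = 6 (|X| = 1, 2) — **0 violations**, and the slack is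
  EXACTLY 0 at `U = {edge sy open}` in every graph (as MDL(∅) is sharp at `1{sy open}`); kit census j183219 (EXHAUSTIVE n = 5: 115 060 pairs, 0 violations).
  NONE OF THIS WAS EVIDENCE ENOUGH: a corner-seeking hill-climb on the slack found the five-vertex witness above (memo §0(4), `CEX-MarkerSplit-g16.md`).
  FALSE VARIANTS (so the `U`-dependence of the constant is essential): the uniform constants `p' + μ(D∩N∩Z)/μ(D∩N)` and `p' + μ(T∩Z)/μ(T)` fail at
  edge level (hold at vertex level); the abstract lattice statement `Cov(f,gh) ≥ E[h | f=0,g=0]·Cov(f,g)` is false already for product measure on `{0,1}³`.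
[cite: VandenbergHaggstromKahn2005, Thm. 1.3 (p. 6), Thm. 1.4 (p. 7) with Remark 1 after Thm. 1.2 (p. 5); Thm. 2.1 (p. 9)]
-/

noncomputable section

namespace Summit.CriticalPhenomena.PercolationContinuityZ3.Theorems

open MeasureTheory Set Literature.Probability.LatticeModels Literature.Probability.Percolation
open scoped Classical

namespace Consts

variable {V : Type*} [Fintype V]

/-- **The exact Y-split identity** `K_N · MDLX(F) = K · C2 − I · C0 + K · μ(T) · P1` (module docstring), for an arbitrary functional `F`
(no monotonicity needed: it is the ring identity behind the split, after `∫_D = ∫_{D∩Y} + ∫_{D∩N}`, `∫_{D∩Z} = ∫_{D∩Y∩Z} + ∫_{D∩N∩Z}` and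
`∫ (1−F) = μ − ∫ F`). [folklore] -/
theorem mdlx_markerSplit_identity (w : Sym2 V → unitInterval) (s y z : V) (X : Set V) (F : Set (Sym2 V) → ℝ) :
    let μ := prodBernoulli w
    let D : Set (BondConfig V) := {ω | ∀ x ∈ X, ¬ (openGraph ω).Reachable s x}
    let T : Set (BondConfig V) := {ω | ∀ x ∈ insert s X, ¬ (openGraph ω).Reachable y x} ∩ D
    let Yv : Set (BondConfig V) := openConn s y
    let Zv : Set (BondConfig V) := openConn s z
    let Wv : Set (BondConfig V) := openConn y z
    let f : BondConfig V → ℝ := fun ω => F (openEdgeCluster ω s)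
    let I := ∫ ω in D, f ω ∂μ
    let K := ∫ ω in D, (1 - f ω) ∂μ
    let IY := ∫ ω in D ∩ Yv, f ω ∂μ
    let IYZ := ∫ ω in D ∩ Yv ∩ Zv, f ω ∂μ
    let IN := ∫ ω in D ∩ Yvᶜ, f ω ∂μ
    let INZ := ∫ ω in D ∩ Yvᶜ ∩ Zv, f ω ∂μ
    let KY := ∫ ω in D ∩ Yv, (1 - f ω) ∂μ
    let KYZ := ∫ ω in D ∩ Yv ∩ Zv, (1 - f ω) ∂μ
    let KN := ∫ ω in D ∩ Yvᶜ, (1 - f ω) ∂μ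
    let KNZ := ∫ ω in D ∩ Yvᶜ ∩ Zv, (1 - f ω) ∂μ
    let MDLX := μ.real T * (μ.real D * (∫ ω in D ∩ Zv, f ω ∂μ) - I * μ.real (D ∩ Zv)) -
      μ.real (T ∩ Wv) * (μ.real D * IY - I * μ.real (D ∩ Yv))
    let Γ := μ.real (T ∩ Wv) * KN + μ.real T * KNZ
    let C2 := μ.real T * KN * IYZ - Γ * IY
    let C0 := μ.real T * KN * KYZ - Γ * KY
    let P1 := μ.real (D ∩ Yvᶜ) * INZ - μ.real (D ∩ Yvᶜ ∩ Zv) * IN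
    KN * MDLX = K * C2 - I * C0 + K * μ.real T * P1 := by
  intro μ D T Yv Zv Wv f I K IY IYZ IN INZ KY KYZ KN KNZ MDLX Γ C2 C0 P1
  -- linear relations between the pieces
  have hI : IY + IN = I := setIntegral_inter_add_compl w D Yv f
  have hK : KY + KN = K := setIntegral_inter_add_compl w D Yv (fun ω => 1 - f ω)
  have hIZ : IYZ + INZ = ∫ ω in D ∩ Zv, f ω ∂μ := by
    have h := setIntegral_inter_add_compl w (D ∩ Zv) Yv f
    rw [show D ∩ Zv ∩ Yv = D ∩ Yv ∩ Zv from inter_right_comm D Zv Yv,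
      show D ∩ Zv ∩ Yvᶜ = D ∩ Yvᶜ ∩ Zv from inter_right_comm D Zv Yvᶜ] at h
    exact h
  have hKY : KY = μ.real (D ∩ Yv) - IY := setIntegral_one_sub w (D ∩ Yv) f
  have hKYZ : KYZ = μ.real (D ∩ Yv ∩ Zv) - IYZ := setIntegral_one_sub w (D ∩ Yv ∩ Zv) f
  have hKN : KN = μ.real (D ∩ Yvᶜ) - IN := setIntegral_one_sub w (D ∩ Yvᶜ) f
  have hKNZ : KNZ = μ.real (D ∩ Yvᶜ ∩ Zv) - INZ := setIntegral_one_sub w (D ∩ Yvᶜ ∩ Zv) f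
  have hKD : K = μ.real D - I := setIntegral_one_sub w D f
  have hmY : μ.real (D ∩ Yv) + μ.real (D ∩ Yvᶜ) = μ.real D := by
    have h := measureReal_inter_add_sdiff (μ := μ) (s := D) (MeasurableSet.of_discrete : MeasurableSet Yv)
    rwa [Set.sdiff_eq] at h
  have hmZ : μ.real (D ∩ Yv ∩ Zv) + μ.real (D ∩ Yvᶜ ∩ Zv) = μ.real (D ∩ Zv) := by
    have h := measureReal_inter_add_sdiff (μ := μ) (s := D ∩ Zv) (MeasurableSet.of_discrete : MeasurableSet Yv)
    rw [Set.sdiff_eq, show D ∩ Zv ∩ Yv = D ∩ Yv ∩ Zv from inter_right_comm D Zv Yv,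
      show D ∩ Zv ∩ Yvᶜ = D ∩ Yvᶜ ∩ Zv from inter_right_comm D Zv Yvᶜ] at h
    exact h
  simp only [MDLX, C2, C0, P1, Γ]
  rw [← hIZ, ← hmZ, ← hI, ← hmY, hKY, hKYZ, hKNZ]
  rw [← hI, ← hmY] at hKD
  rw [hKD, hKN]
  ring

/-- **MDL(X)′ from the marker split.**  For monotone `F` with `F ≤ 1` and `K_N = ∫_{D∩N}(1−F) > 0`: if `K·C2 ≥ I·C0` (the conjecture
`Consts.MarkerSplit` at `F`; for indicators `Cov_ν(U, Y∩Z) ≥ (p' + ν(Z|Uᶜ,N))·Cov_ν(U,Y)`), then the inequality of `Consts.MDLXJoint` holds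
at `F`.  Proof: the identity `Consts.mdlx_markerSplit_identity` and `P1 ≥ 0` (`Consts.markerPA_ge`).
[cite: VandenbergHaggstromKahn2005, Thm. 1.3 (p. 6), Remark 1 (p. 5)] -/
theorem mdlxJoint_of_markerSplit (w : Sym2 V → unitInterval) (s y z : V) (X : Set V) (F : Set (Sym2 V) → ℝ)
    (hF : Monotone F) (hF1 : ∀ C, F C ≤ 1)
    (hKN : 0 < ∫ ω in {ω : BondConfig V | ∀ x ∈ X, ¬ (openGraph ω).Reachable s x} ∩ (openConn s y)ᶜ,
      (1 - F (openEdgeCluster ω s)) ∂(prodBernoulli w))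
    (hS0 : (∫ ω in {ω : BondConfig V | ∀ x ∈ X, ¬ (openGraph ω).Reachable s x}, F (openEdgeCluster ω s) ∂(prodBernoulli w)) *
        ((prodBernoulli w).real ({ω : BondConfig V | ∀ x ∈ insert s X, ¬ (openGraph ω).Reachable y x} ∩
              {ω | ∀ x ∈ X, ¬ (openGraph ω).Reachable s x}) *
            (∫ ω in {ω : BondConfig V | ∀ x ∈ X, ¬ (openGraph ω).Reachable s x} ∩ (openConn s y)ᶜ,
              (1 - F (openEdgeCluster ω s)) ∂(prodBernoulli w)) *
            (∫ ω in {ω : BondConfig V | ∀ x ∈ X, ¬ (openGraph ω).Reachable s x} ∩ openConn s y ∩ openConn s z,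
              (1 - F (openEdgeCluster ω s)) ∂(prodBernoulli w)) -
          ((prodBernoulli w).real ({ω : BondConfig V | ∀ x ∈ insert s X, ¬ (openGraph ω).Reachable y x} ∩
                {ω | ∀ x ∈ X, ¬ (openGraph ω).Reachable s x} ∩ openConn y z) *
              (∫ ω in {ω : BondConfig V | ∀ x ∈ X, ¬ (openGraph ω).Reachable s x} ∩ (openConn s y)ᶜ,
                (1 - F (openEdgeCluster ω s)) ∂(prodBernoulli w)) +
            (prodBernoulli w).real ({ω : BondConfig V | ∀ x ∈ insert s X, ¬ (openGraph ω).Reachable y x} ∩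
                {ω | ∀ x ∈ X, ¬ (openGraph ω).Reachable s x}) *
              (∫ ω in {ω : BondConfig V | ∀ x ∈ X, ¬ (openGraph ω).Reachable s x} ∩ (openConn s y)ᶜ ∩ openConn s z,
                (1 - F (openEdgeCluster ω s)) ∂(prodBernoulli w))) *
          (∫ ω in {ω : BondConfig V | ∀ x ∈ X, ¬ (openGraph ω).Reachable s x} ∩ openConn s y,
              (1 - F (openEdgeCluster ω s)) ∂(prodBernoulli w))) ≤
      (∫ ω in {ω : BondConfig V | ∀ x ∈ X, ¬ (openGraph ω).Reachable s x}, (1 - F (openEdgeCluster ω s)) ∂(prodBernoulli w)) *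
        ((prodBernoulli w).real ({ω : BondConfig V | ∀ x ∈ insert s X, ¬ (openGraph ω).Reachable y x} ∩
              {ω | ∀ x ∈ X, ¬ (openGraph ω).Reachable s x}) *
            (∫ ω in {ω : BondConfig V | ∀ x ∈ X, ¬ (openGraph ω).Reachable s x} ∩ (openConn s y)ᶜ,
              (1 - F (openEdgeCluster ω s)) ∂(prodBernoulli w)) *
            (∫ ω in {ω : BondConfig V | ∀ x ∈ X, ¬ (openGraph ω).Reachable s x} ∩ openConn s y ∩ openConn s z,
              F (openEdgeCluster ω s) ∂(prodBernoulli w)) -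
          ((prodBernoulli w).real ({ω : BondConfig V | ∀ x ∈ insert s X, ¬ (openGraph ω).Reachable y x} ∩
                {ω | ∀ x ∈ X, ¬ (openGraph ω).Reachable s x} ∩ openConn y z) *
              (∫ ω in {ω : BondConfig V | ∀ x ∈ X, ¬ (openGraph ω).Reachable s x} ∩ (openConn s y)ᶜ,
                (1 - F (openEdgeCluster ω s)) ∂(prodBernoulli w)) +
            (prodBernoulli w).real ({ω : BondConfig V | ∀ x ∈ insert s X, ¬ (openGraph ω).Reachable y x} ∩
                {ω | ∀ x ∈ X, ¬ (openGraph ω).Reachable s x}) *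
              (∫ ω in {ω : BondConfig V | ∀ x ∈ X, ¬ (openGraph ω).Reachable s x} ∩ (openConn s y)ᶜ ∩ openConn s z,
                (1 - F (openEdgeCluster ω s)) ∂(prodBernoulli w))) *
          (∫ ω in {ω : BondConfig V | ∀ x ∈ X, ¬ (openGraph ω).Reachable s x} ∩ openConn s y,
              F (openEdgeCluster ω s) ∂(prodBernoulli w)))) :
    (prodBernoulli w).real ({ω : BondConfig V | ∀ x ∈ insert s X, ¬ (openGraph ω).Reachable y x} ∩
          {ω | ∀ x ∈ X, ¬ (openGraph ω).Reachable s x} ∩ openConn y z) *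
        ((prodBernoulli w).real {ω : BondConfig V | ∀ x ∈ X, ¬ (openGraph ω).Reachable s x} *
            (∫ ω in {ω : BondConfig V | ∀ x ∈ X, ¬ (openGraph ω).Reachable s x} ∩ openConn s y,
              F (openEdgeCluster ω s) ∂(prodBernoulli w)) -
          (∫ ω in {ω : BondConfig V | ∀ x ∈ X, ¬ (openGraph ω).Reachable s x},
              F (openEdgeCluster ω s) ∂(prodBernoulli w)) *
            (prodBernoulli w).real ({ω : BondConfig V | ∀ x ∈ X, ¬ (openGraph ω).Reachable s x} ∩ openConn s y)) ≤
      (prodBernoulli w).real ({ω : BondConfig V | ∀ x ∈ insert s X, ¬ (openGraph ω).Reachable y x} ∩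
          {ω | ∀ x ∈ X, ¬ (openGraph ω).Reachable s x}) *
        ((prodBernoulli w).real {ω : BondConfig V | ∀ x ∈ X, ¬ (openGraph ω).Reachable s x} *
            (∫ ω in {ω : BondConfig V | ∀ x ∈ X, ¬ (openGraph ω).Reachable s x} ∩ openConn s z,
              F (openEdgeCluster ω s) ∂(prodBernoulli w)) -
          (∫ ω in {ω : BondConfig V | ∀ x ∈ X, ¬ (openGraph ω).Reachable s x},
              F (openEdgeCluster ω s) ∂(prodBernoulli w)) *
            (prodBernoulli w).real ({ω : BondConfig V | ∀ x ∈ X, ¬ (openGraph ω).Reachable s x} ∩ openConn s z)) := by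
  have hid := mdlx_markerSplit_identity w s y z X F
  simp only at hid
  have hP1 := markerPA_ge w s y z X F hF
  have hmeas : ∀ S : Set (BondConfig V), MeasurableSet S := fun _ => MeasurableSet.of_discrete
  have h0 : ∀ S : Set (BondConfig V), 0 ≤ (prodBernoulli w).real S := fun _ => measureReal_nonneg
  have hK0 : 0 ≤ ∫ ω in {ω : BondConfig V | ∀ x ∈ X, ¬ (openGraph ω).Reachable s x}, (1 - F (openEdgeCluster ω s)) ∂(prodBernoulli w) :=
    setIntegral_nonneg (hmeas _) fun ω _ => sub_nonneg.2 (hF1 _)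
  -- K_N · MDLX = K·C2 − I·C0 + K·μT·P1 ≥ 0 + K·μT·P1 ≥ 0, then divide by K_N > 0
  have hT0 := h0 ({ω : BondConfig V | ∀ x ∈ insert s X, ¬ (openGraph ω).Reachable y x} ∩
    {ω | ∀ x ∈ X, ¬ (openGraph ω).Reachable s x})
  have hprod : 0 ≤ (∫ ω in {ω : BondConfig V | ∀ x ∈ X, ¬ (openGraph ω).Reachable s x}, (1 - F (openEdgeCluster ω s)) ∂(prodBernoulli w)) *
      (prodBernoulli w).real ({ω : BondConfig V | ∀ x ∈ insert s X, ¬ (openGraph ω).Reachable y x} ∩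
        {ω | ∀ x ∈ X, ¬ (openGraph ω).Reachable s x}) *
      ((prodBernoulli w).real ({ω : BondConfig V | ∀ x ∈ X, ¬ (openGraph ω).Reachable s x} ∩ (openConn s y)ᶜ) *
          (∫ ω in {ω : BondConfig V | ∀ x ∈ X, ¬ (openGraph ω).Reachable s x} ∩ (openConn s y)ᶜ ∩ openConn s z,
            F (openEdgeCluster ω s) ∂(prodBernoulli w)) -
        (prodBernoulli w).real ({ω : BondConfig V | ∀ x ∈ X, ¬ (openGraph ω).Reachable s x} ∩ (openConn s y)ᶜ ∩ openConn s z) *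
          (∫ ω in {ω : BondConfig V | ∀ x ∈ X, ¬ (openGraph ω).Reachable s x} ∩ (openConn s y)ᶜ,
            F (openEdgeCluster ω s) ∂(prodBernoulli w))) :=
    mul_nonneg (mul_nonneg hK0 hT0) (sub_nonneg.2 hP1)
  refine le_of_sub_nonneg ?_
  refine nonneg_of_mul_nonneg_right (a := ∫ ω in {ω : BondConfig V | ∀ x ∈ X, ¬ (openGraph ω).Reachable s x} ∩ (openConn s y)ᶜ,
      (1 - F (openEdgeCluster ω s)) ∂(prodBernoulli w)) ?_ hKN
  nlinarith [hid, hS0, hprod]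

/-- **THEOREM: MDL(X)′ holds at every functional whose LOWER conditioned marker slack is `≤ 0`.**  For monotone `F` with `0 ≤ F ≤ 1` and
`K_N > 0`: if `C0 ≤ 0`, i.e. `μ(T) K_N K_{Y∩Z} ≤ (μ(T∩W) K_N + μ(T) K_{N∩Z}) K_Y` (for `F = 1_U`: `ν(Z | Uᶜ, Y) ≤ p' + ν(Z | Uᶜ, N)`), then the
inequality of `Consts.MDLXJoint` holds at `F` — by `C2 ≥ 0` (`Consts.conditionedMarker_ge` with `G = 1 − F`) and `Consts.mdlxJoint_of_markerSplit`.
[cite: VandenbergHaggstromKahn2005, Thm. 1.3 (p. 6), Thm. 1.4 (p. 7) — corollary derived here] -/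
theorem mdlxJoint_of_lowerMarker_le (w : Sym2 V → unitInterval) (s y z : V) (X : Set V) (F : Set (Sym2 V) → ℝ)
    (hF : Monotone F) (hF0 : ∀ C, 0 ≤ F C) (hF1 : ∀ C, F C ≤ 1)
    (hKN : 0 < ∫ ω in {ω : BondConfig V | ∀ x ∈ X, ¬ (openGraph ω).Reachable s x} ∩ (openConn s y)ᶜ,
      (1 - F (openEdgeCluster ω s)) ∂(prodBernoulli w))
    (hC0 : (prodBernoulli w).real ({ω : BondConfig V | ∀ x ∈ insert s X, ¬ (openGraph ω).Reachable y x} ∩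
            {ω | ∀ x ∈ X, ¬ (openGraph ω).Reachable s x}) *
          (∫ ω in {ω : BondConfig V | ∀ x ∈ X, ¬ (openGraph ω).Reachable s x} ∩ (openConn s y)ᶜ,
            (1 - F (openEdgeCluster ω s)) ∂(prodBernoulli w)) *
          (∫ ω in {ω : BondConfig V | ∀ x ∈ X, ¬ (openGraph ω).Reachable s x} ∩ openConn s y ∩ openConn s z,
            (1 - F (openEdgeCluster ω s)) ∂(prodBernoulli w)) ≤
        ((prodBernoulli w).real ({ω : BondConfig V | ∀ x ∈ insert s X, ¬ (openGraph ω).Reachable y x} ∩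
              {ω | ∀ x ∈ X, ¬ (openGraph ω).Reachable s x} ∩ openConn y z) *
            (∫ ω in {ω : BondConfig V | ∀ x ∈ X, ¬ (openGraph ω).Reachable s x} ∩ (openConn s y)ᶜ,
              (1 - F (openEdgeCluster ω s)) ∂(prodBernoulli w)) +
          (prodBernoulli w).real ({ω : BondConfig V | ∀ x ∈ insert s X, ¬ (openGraph ω).Reachable y x} ∩
              {ω | ∀ x ∈ X, ¬ (openGraph ω).Reachable s x}) *
            (∫ ω in {ω : BondConfig V | ∀ x ∈ X, ¬ (openGraph ω).Reachable s x} ∩ (openConn s y)ᶜ ∩ openConn s z,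
              (1 - F (openEdgeCluster ω s)) ∂(prodBernoulli w))) *
        (∫ ω in {ω : BondConfig V | ∀ x ∈ X, ¬ (openGraph ω).Reachable s x} ∩ openConn s y,
            (1 - F (openEdgeCluster ω s)) ∂(prodBernoulli w))) :
    (prodBernoulli w).real ({ω : BondConfig V | ∀ x ∈ insert s X, ¬ (openGraph ω).Reachable y x} ∩
          {ω | ∀ x ∈ X, ¬ (openGraph ω).Reachable s x} ∩ openConn y z) *
        ((prodBernoulli w).real {ω : BondConfig V | ∀ x ∈ X, ¬ (openGraph ω).Reachable s x} *
            (∫ ω in {ω : BondConfig V | ∀ x ∈ X, ¬ (openGraph ω).Reachable s x} ∩ openConn s y,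
              F (openEdgeCluster ω s) ∂(prodBernoulli w)) -
          (∫ ω in {ω : BondConfig V | ∀ x ∈ X, ¬ (openGraph ω).Reachable s x},
              F (openEdgeCluster ω s) ∂(prodBernoulli w)) *
            (prodBernoulli w).real ({ω : BondConfig V | ∀ x ∈ X, ¬ (openGraph ω).Reachable s x} ∩ openConn s y)) ≤
      (prodBernoulli w).real ({ω : BondConfig V | ∀ x ∈ insert s X, ¬ (openGraph ω).Reachable y x} ∩
          {ω | ∀ x ∈ X, ¬ (openGraph ω).Reachable s x}) *
        ((prodBernoulli w).real {ω : BondConfig V | ∀ x ∈ X, ¬ (openGraph ω).Reachable s x} *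
            (∫ ω in {ω : BondConfig V | ∀ x ∈ X, ¬ (openGraph ω).Reachable s x} ∩ openConn s z,
              F (openEdgeCluster ω s) ∂(prodBernoulli w)) -
          (∫ ω in {ω : BondConfig V | ∀ x ∈ X, ¬ (openGraph ω).Reachable s x},
              F (openEdgeCluster ω s) ∂(prodBernoulli w)) *
            (prodBernoulli w).real ({ω : BondConfig V | ∀ x ∈ X, ¬ (openGraph ω).Reachable s x} ∩ openConn s z)) := by
  have hmeas : ∀ S : Set (BondConfig V), MeasurableSet S := fun _ => MeasurableSet.of_discrete
  -- C2 ≥ 0 with G = 1 − F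
  have hC2 := conditionedMarker_ge w s y z X F (fun C => 1 - F C) hF (fun a b hab => sub_le_sub_left (hF hab) 1) hF0
    (fun C => sub_nonneg.2 (hF1 C))
  have hI0 : 0 ≤ ∫ ω in {ω : BondConfig V | ∀ x ∈ X, ¬ (openGraph ω).Reachable s x}, F (openEdgeCluster ω s) ∂(prodBernoulli w) :=
    setIntegral_nonneg (hmeas _) fun ω _ => hF0 _
  have hK0 : 0 ≤ ∫ ω in {ω : BondConfig V | ∀ x ∈ X, ¬ (openGraph ω).Reachable s x}, (1 - F (openEdgeCluster ω s)) ∂(prodBernoulli w) :=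
    setIntegral_nonneg (hmeas _) fun ω _ => sub_nonneg.2 (hF1 _)
  refine mdlxJoint_of_markerSplit w s y z X F hF hF1 hKN ?_
  nlinarith [mul_le_mul_of_nonneg_left hC0 hI0, mul_le_mul_of_nonneg_left hC2 hK0]

/-- **S0, the marker split of MDL(X)′ (gen 16) — typed as a conjecture on 2026-08-23 and REFUTED the same day** (`Consts.not_markerSplit` in
`…ConstsMarkerSplitRefutation.lean`: five vertices, `X = ∅`, single-edge cylinder at the owner; the statement below is FALSE as a universal
statement, kept because `Consts.mdlxJoint_of_markerSplit` uses it hypothesis-wise, functional by functional).  For every finite weighted graph (`Fin n`, weights `w`, `μ = prodBernoulli w`), owner `s`, avoided set `X`, markers `y ≠ s` and `z`,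
and every monotone functional `F` of the open edge cluster of `s` with `0 ≤ F ≤ 1`:  `K · C2 ≥ I · C0`, i.e.
`(∫_D (1−F)) · [μ(T) K_N I_{Y∩Z} − Γ I_Y] ≥ (∫_D F) · [μ(T) K_N K_{Y∩Z} − Γ K_Y]`, `Γ = μ(T∩W) K_N + μ(T) K_{N∩Z}`
(`D = {s↮X}`, `T = {y↮{s}∪X} ∩ D`, `Y = {s↔y}`, `N = Yᶜ`, `Z = {s↔z}`, `W = {y↔z}`, `I_A = ∫_{D∩A} F`, `K_A = ∫_{D∩A}(1−F)`).  For `F = 1_U`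
(`U` an up-event of `C_s`, `ν = μ(·|D)`):  `Cov_ν(U, Y∩Z) ≥ (p' + ν(Z | Uᶜ, N)) · Cov_ν(U, Y)`.  It implies `Consts.MDLXJoint` functional by
functional (`Consts.mdlxJoint_of_markerSplit`; the difference is exactly the positive-association term `K·μ(T)·P1`), the part `C2 ≥ 0` is the
theorem `Consts.conditionedMarker_ge`; equality at `U = {edge sy open}` in every graph; 0 violations in an exact census of > 1.5·10⁵ (instance, U)
pairs — and nevertheless FALSE (witness in the module docstring).  builds on p205010 (kernel theorem, internal audit signed; external
expert review pending). [cite: VandenbergHaggstromKahn2005, Thm. 1.3 (p. 6), Thm. 1.4 (p. 7); §2.1 pp. 10–13] [status: refuted — `Consts.not_markerSplit`] -/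
@[conjecture] def MarkerSplit : Prop :=
  ∀ (n : ℕ) (w : Sym2 (Fin n) → unitInterval) (s y z : Fin n) (X : Set (Fin n)), s ≠ y →
    ∀ F : Set (Sym2 (Fin n)) → ℝ, Monotone F → (∀ C, 0 ≤ F C) → (∀ C, F C ≤ 1) →
    (∫ ω in {ω : BondConfig (Fin n) | ∀ x ∈ X, ¬ (openGraph ω).Reachable s x}, F (openEdgeCluster ω s) ∂(prodBernoulli w)) *
        ((prodBernoulli w).real ({ω : BondConfig (Fin n) | ∀ x ∈ insert s X, ¬ (openGraph ω).Reachable y x} ∩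
              {ω | ∀ x ∈ X, ¬ (openGraph ω).Reachable s x}) *
            (∫ ω in {ω : BondConfig (Fin n) | ∀ x ∈ X, ¬ (openGraph ω).Reachable s x} ∩ (openConn s y)ᶜ,
              (1 - F (openEdgeCluster ω s)) ∂(prodBernoulli w)) *
            (∫ ω in {ω : BondConfig (Fin n) | ∀ x ∈ X, ¬ (openGraph ω).Reachable s x} ∩ openConn s y ∩ openConn s z,
              (1 - F (openEdgeCluster ω s)) ∂(prodBernoulli w)) -
          ((prodBernoulli w).real ({ω : BondConfig (Fin n) | ∀ x ∈ insert s X, ¬ (openGraph ω).Reachable y x} ∩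
                {ω | ∀ x ∈ X, ¬ (openGraph ω).Reachable s x} ∩ openConn y z) *
              (∫ ω in {ω : BondConfig (Fin n) | ∀ x ∈ X, ¬ (openGraph ω).Reachable s x} ∩ (openConn s y)ᶜ,
                (1 - F (openEdgeCluster ω s)) ∂(prodBernoulli w)) +
            (prodBernoulli w).real ({ω : BondConfig (Fin n) | ∀ x ∈ insert s X, ¬ (openGraph ω).Reachable y x} ∩
                {ω | ∀ x ∈ X, ¬ (openGraph ω).Reachable s x}) *
              (∫ ω in {ω : BondConfig (Fin n) | ∀ x ∈ X, ¬ (openGraph ω).Reachable s x} ∩ (openConn s y)ᶜ ∩ openConn s z,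
                (1 - F (openEdgeCluster ω s)) ∂(prodBernoulli w))) *
          (∫ ω in {ω : BondConfig (Fin n) | ∀ x ∈ X, ¬ (openGraph ω).Reachable s x} ∩ openConn s y,
              (1 - F (openEdgeCluster ω s)) ∂(prodBernoulli w))) ≤
      (∫ ω in {ω : BondConfig (Fin n) | ∀ x ∈ X, ¬ (openGraph ω).Reachable s x}, (1 - F (openEdgeCluster ω s)) ∂(prodBernoulli w)) *
        ((prodBernoulli w).real ({ω : BondConfig (Fin n) | ∀ x ∈ insert s X, ¬ (openGraph ω).Reachable y x} ∩
              {ω | ∀ x ∈ X, ¬ (openGraph ω).Reachable s x}) *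
            (∫ ω in {ω : BondConfig (Fin n) | ∀ x ∈ X, ¬ (openGraph ω).Reachable s x} ∩ (openConn s y)ᶜ,
              (1 - F (openEdgeCluster ω s)) ∂(prodBernoulli w)) *
            (∫ ω in {ω : BondConfig (Fin n) | ∀ x ∈ X, ¬ (openGraph ω).Reachable s x} ∩ openConn s y ∩ openConn s z,
              F (openEdgeCluster ω s) ∂(prodBernoulli w)) -
          ((prodBernoulli w).real ({ω : BondConfig (Fin n) | ∀ x ∈ insert s X, ¬ (openGraph ω).Reachable y x} ∩
                {ω | ∀ x ∈ X, ¬ (openGraph ω).Reachable s x} ∩ openConn y z) *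
              (∫ ω in {ω : BondConfig (Fin n) | ∀ x ∈ X, ¬ (openGraph ω).Reachable s x} ∩ (openConn s y)ᶜ,
                (1 - F (openEdgeCluster ω s)) ∂(prodBernoulli w)) +
            (prodBernoulli w).real ({ω : BondConfig (Fin n) | ∀ x ∈ insert s X, ¬ (openGraph ω).Reachable y x} ∩
                {ω | ∀ x ∈ X, ¬ (openGraph ω).Reachable s x}) *
              (∫ ω in {ω : BondConfig (Fin n) | ∀ x ∈ X, ¬ (openGraph ω).Reachable s x} ∩ (openConn s y)ᶜ ∩ openConn s z,
                (1 - F (openEdgeCluster ω s)) ∂(prodBernoulli w))) *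
          (∫ ω in {ω : BondConfig (Fin n) | ∀ x ∈ X, ¬ (openGraph ω).Reachable s x} ∩ openConn s y,
              F (openEdgeCluster ω s) ∂(prodBernoulli w)))

end Consts

end Summit.CriticalPhenomena.PercolationContinuityZ3.Theorems

end
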